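import Mathlib
import Literature.NumberTheory.Sieve.PretentiousDistance
import Literature.NumberTheory.LFunctions.TaoLogChowla
import Literature.NumberTheory.LFunctions.TaoLogElliottReduction
import Literature.NumberTheory.LFunctions.PretentiousZeta
import Literature.NumberTheory.LFunctions.VanDerCorputZeta
import Literature.NumberTheory.Sieve.PrimePowersInProgressions
import HarnessLib

/-!
# The Liouville function is non-pretentious (Tao 2016, hypothesis (1.6)) — unconditionally

Topic `Literature/NumberTheory/LFunctions`. NO named facts: everything in this file is PROVED.

This file proves `Literature.NumberTheory.LFunctions.Tao2016_liouvilleNonpretentious` (`TaoLogChowla`: the hypothesis of Tao 2016,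
Theorem 1.3 for `g₁ = λ` at every level `A` — for `x` large, `𝔻(λ, χ(n)n^{it}; x)² ≥ A` for all
moduli `1 ≤ q ≤ A`, all `χ` mod `q`, all `|t| ≤ A x`), and with it the two named facts
`Literature.NumberTheory.Sieve.isNonpretentious_liouville`, `Literature.NumberTheory.Sieve.isNonpretentious_moebius` of `PretentiousDistance`
(`isNonpretentious_liouville_holds`, `isNonpretentious_moebius_holds`).

Consequently `Literature.NumberTheory.Sieve.tao_log_chowla_liouville` (parity.S21; Tao 2016, Thm 1.2 with `ω = x`)
follows from the single named fact `Literature.NumberTheory.LFunctions.Tao2016_theorem23` (Tao 2016, Theorem 2.3, the reduced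
form of the logarithmically averaged Elliott theorem proved in §§3–4 of the paper by the entropy
decrement argument): `Literature.NumberTheory.LFunctions.tao_log_chowla_liouville_of_theorem23`. This is the route the
paper indicates for `λ` (§2, first paragraph: "Readers who are interested just in the case of the
Liouville function (Theorem 1.2) can skip the initial reductions and move directly to Theorem 2.3"):
`λ` is completely multiplicative with values in `{±1} ⊂ S¹`, so Propositions 2.1–2.2 are not
needed, and the substitution `(a₁, a₂, b₁, b₂) ↦ (a₁a₂, a₁a₂, a₂b₁, a₁b₂)` together with the choice
`ω = x / log x` (loc. cit., the two paragraphs before Theorem 2.3) is carried out here. It also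
follows from `Literature.NumberTheory.LFunctions.tao_log_averaged_elliott_two` (Tao 2016, Thm 1.3) alone
(`Literature.NumberTheory.LFunctions.tao_log_chowla_liouville_of_elliott_two`).

Tao (2016, §1 after Remark 1.6) attributes the hypothesis for `λ` to "the Vinogradov–Korobov
zero-free region for `L`-functions" (cf. Matomäki–Radziwiłł–Tao 2015, (1.12):
`M(λ; X, Q) ≥ (1/3 - ε) log log X + O(1)`). The observation used here is that, because Theorem 1.3
fixes the level `A` before letting `x → ∞`, only finitely many characters are involved, and for
each fixed `χ` the growth `inf_{|t| ≤ Ax} 𝔻(λ, χ(n)n^{it}; x)² → ∞` needs analytic input only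
through the size of `ζ(1 + 1/log x + iu)`, `2 ≤ |u| ≤ x²`, for which the classical van der Corput
estimate `ζ(σ + iu) = o(log |u|)` (`1 < σ ≤ 2`; proved in `VanDerCorputZeta` following
Graham–Kolesnik 1991, Ch. 2, and Titchmarsh 1986, Ch. V) suffices.

Proof architecture (`σ_x = 1 + 1/log x`; the distance formulas (D1a)/(D1c) and Mertens' theorem are
imported from `PretentiousZeta`):
* `log_norm_zeta_sigmaX_le`: from `Literature.NumberTheory.LFunctions.VdC.norm_zeta_le_log_div_abs`, for every `B`,
  `log |ζ(σ_x - iu)| ≤ log log x - B` for `x ≥ x₁(B)` and `2 ≤ |u| ≤ x²`.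
* The **`k`-trick** (`pretentiousDistSq_one_le_totient_trick`): `𝔻(1, n^{ikt}; x)² ≤ k² 𝔻(λ, χ(n)n^{it}; x)²`
  with `k = 2φ(q)`, from `|1 - v^k| ≤ k|1 - v|` for `v = -χ(p)p^{it}` and Euler's `χ(p)^{φ(q)} = 1`.
* `|t| ≥ 1` (`liouville_dist_large_t`): with `u = kt`, `2 ≤ |u| ≤ x²`, so (D1c) and the two items
  above give `𝔻(λ, χn^{it}; x)² ≥ B` for `x` large (any `B`).
* `|t| ≤ 1`, `χ ≠ χ₀` (`liouville_dist_small_t_nontrivial`):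
  `𝔻(λ, χn^{it}; x)² = 2∑_{p ≤ x} 1/p - 𝔻(1, χn^{it}; x)² = log log x + log |L(σ_x - it, χ)| + O(1)`, and
  `|L(s, χ)|` is bounded below on `[1,2] × [-1,1]` (Mathlib: `DirichletCharacter.differentiable_LFunction`,
  `DirichletCharacter.LFunction_ne_zero_of_one_le_re`).
* `|t| ≤ 1`, `χ = χ₀` (`pretentiousDistSq_liouville_principal_ge`, `liouville_dist_small_t_modOne`):
  reduce to `q = 1` at a cost `≤ q`; for `|t| ≤ (log x)^{-1/2}` use `Re p^{it} = cos(t log p) ≥ 0` for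
  `p ≤ exp(√log x)` and Mertens (`liouville_dist_tiny_t`); for `(log x)^{-1/2} < |t| ≤ 1` use Mertens'
  `3-4-1` inequality (Mathlib `DirichletCharacter.norm_LSeries_product_ge_one`) together with
  `ζ(σ_x) ≤ 2 log x` and `|ζ(σ_x + 2it)| ≤ (1/2 + O(1)) (log x)^{1/2}`, giving
  `log |ζ(σ_x + it)| ≥ -(7/8) log log x - C` (`exists_log_norm_zeta_sigmaX_ge`, `liouville_dist_medium_t`).
* Assembly over the finitely many characters of modulus `≤ A` (`liouville_dist_eventually_ge`,
  `Tao2016_liouvilleNonpretentious_holds`).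
* Corollaries: `isNonpretentious_liouville_holds`, `isNonpretentious_moebius_holds`;
  `Parity.tao_log_chowla_liouville_of_elliott_two` (parity.S21 from Thm 1.3);
  `Parity.tao_log_chowla_liouville_of_theorem23` (parity.S21 from Thm 2.3).

## References
* T. Tao, *The logarithmically averaged Chowla and Elliott conjectures for two-point correlations*,
  Forum Math. Pi 4 (2016), e8; arXiv:1509.05422: §1 (after Remark 1.6), §2 (first paragraph, the
  two paragraphs before Theorem 2.3, Theorem 2.3).
* K. Matomäki, M. Radziwiłł, T. Tao, *An averaged form of Chowla's conjecture*, Algebra & Number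
  Theory 9 (2015), §1, (1.12).
* S. W. Graham, G. Kolesnik, *Van der Corput's Method of Exponential Sums*, LMS Lecture Note
  Series 126, Cambridge University Press 1991, Ch. 2 (via `VanDerCorputZeta`).
* E. C. Titchmarsh, *The Theory of the Riemann Zeta-Function*, 2nd ed. (rev. D. R. Heath-Brown),
  Oxford 1986, Ch. V (via `VanDerCorputZeta`).

## Design choices
* All thresholds and constants are existential (`∃ x₁ C, …`); the final statements are the `Prop`s
  already defined in `TaoLogChowla`, `TaoLogElliottReduction`, `PretentiousDistance` and
  `ParityWave0`, unchanged.
* In `Parity.tao_log_chowla_liouville_of_theorem23` the head `n ≤ log x` of the logarithmic sum is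
  bounded by the harmonic bound `∑_{n ≤ m} 1/n ≤ 1 + log m` (Mathlib `harmonic_le_one_add_log`),
  and `log log x = o(log x)` (Mathlib `Real.isLittleO_log_id_atTop`).
-/

open Finset Real

namespace Literature.NumberTheory.LFunctions

open Complex in
/-- **The input from van der Corput's method.** For every real `B` there is `x₁` such that for
`x ≥ x₁` and `2 ≤ |u| ≤ x²`: `log |ζ(σ_x - iu)| ≤ log log x - B`. Indeed
`Literature.NumberTheory.LFunctions.VdC.norm_zeta_le_log_div_abs` (for every `K ≥ 1`: `|ζ(σ + iu)| ≤ (log |u|)/K + C_K` for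
`1 < σ ≤ 2`, `|u| ≥ 2`) with `K ≥ 3e^B` gives `|ζ(σ_x - iu)| ≤ 2 (log x)/K + C_K ≤ 3 (log x)/K`
once `log x ≥ K C_K`. (Graham–Kolesnik 1991, Thm 2.14 / Titchmarsh 1986, Thm 5.16 give the sharper
`ζ(1 + it) ≪ log t / log log t`; only `o(log t)` is used.) [folklore] -/
theorem log_norm_zeta_sigmaX_le (B : ℝ) :
    ∃ x₁ : ℝ, ∀ x : ℝ, x₁ ≤ x → ∀ u : ℝ, 2 ≤ |u| → |u| ≤ x ^ 2 →
      Real.log ‖riemannZeta ((sigmaX x : ℂ) - u * I)‖ ≤ Real.log (Real.log x) - B := by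
  set K : ℕ := ⌈3 * Real.exp B⌉₊ + 1 with hK
  have hK1 : 1 ≤ K := by rw [hK]; exact Nat.le_add_left 1 _
  obtain ⟨C, hC⟩ := VdC.norm_zeta_le_log_div_abs K hK1
  have hK0 : (0 : ℝ) < K := by exact_mod_cast hK1
  have hKB : 3 * Real.exp B ≤ K := by
    rw [hK]
    push_cast
    linarith [Nat.le_ceil (3 * Real.exp B)]
  refine ⟨max 3 (Real.exp (K * max C 0)), fun x hx u hu2 hux => ?_⟩
  have hx3 : 3 ≤ x := (le_max_left _ _).trans hx
  have hx1 : (1 : ℝ) < x := by linarith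
  have hx0 : (0 : ℝ) < x := by linarith
  have hlogx : 1 ≤ Real.log x := one_le_log_of_exp_le (Real.exp_one_lt_three.le.trans hx3)
  have hlogx0 : 0 < Real.log x := by linarith
  have hσ1 : 1 < sigmaX x := one_lt_sigmaX hx1
  have hσ2 : sigmaX x ≤ 2 := sigmaX_le_two (Real.exp_one_lt_three.le.trans hx3)
  have hu0 : 0 < |u| := by linarith
  -- `K · max(C, 0) ≤ log x`
  have hClog : (K : ℝ) * max C 0 ≤ Real.log x := by
    have h := Real.log_le_log (Real.exp_pos _) ((le_max_right _ _).trans hx)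
    rwa [Real.log_exp] at h
  -- the van der Corput bound at `σ_x + i(-u)`
  have hb := hC (sigmaX x) (-u) hσ1 hσ2 (by rwa [abs_neg])
  have hrew : ((sigmaX x : ℂ) + ((-u : ℝ) : ℂ) * I) = (sigmaX x : ℂ) - u * I := by
    push_cast
    ring
  rw [hrew, abs_neg] at hb
  have hlogu : Real.log |u| ≤ 2 * Real.log x := by
    rw [← Real.log_rpow hx0, Real.rpow_two]
    exact Real.log_le_log hu0 hux
  have hζ : ‖riemannZeta ((sigmaX x : ℂ) - u * I)‖ ≤ 3 * Real.log x / K := by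
    have hmax : max C 0 ≤ Real.log x / K := by
      rw [le_div_iff₀ hK0]
      linarith
    calc ‖riemannZeta ((sigmaX x : ℂ) - u * I)‖ ≤ Real.log |u| / K + C := hb
      _ ≤ 2 * Real.log x / K + max C 0 := by
          gcongr
          exact le_max_left _ _
      _ ≤ 2 * Real.log x / K + Real.log x / K := by linarith
      _ = 3 * Real.log x / K := by ring
  have hpos : 0 < ‖riemannZeta ((sigmaX x : ℂ) - u * I)‖ := by
    refine norm_pos_iff.2 (riemannZeta_ne_zero_of_one_lt_re ?_)
    simpa using hσ1
  have h3K : Real.log (3 / K) ≤ -B := by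
    have h3K0 : (0 : ℝ) < 3 / K := by positivity
    have hle : 3 / (K : ℝ) ≤ Real.exp (-B) := by
      rw [div_le_iff₀ hK0, Real.exp_neg]
      have hE := Real.exp_pos B
      calc (3 : ℝ) = 3 * Real.exp B * (Real.exp B)⁻¹ := by field_simp
        _ ≤ K * (Real.exp B)⁻¹ := by gcongr
        _ = (Real.exp B)⁻¹ * K := mul_comm _ _
    calc Real.log (3 / K) ≤ Real.log (Real.exp (-B)) := Real.log_le_log h3K0 hle
      _ = -B := Real.log_exp _
  calc Real.log ‖riemannZeta ((sigmaX x : ℂ) - u * I)‖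
      ≤ Real.log (3 * Real.log x / K) := Real.log_le_log hpos hζ
    _ = Real.log (Real.log x) + Real.log (3 / K) := by
        rw [show 3 * Real.log x / K = Real.log x * (3 / K) by ring,
          Real.log_mul hlogx0.ne' (by positivity)]
    _ ≤ Real.log (Real.log x) - B := by linarith

/-! ### The `k`-trick: `𝔻(1, n^{ikt}; x)² ≤ k² 𝔻(λ, χ(n)n^{it}; x)²` with `k = 2φ(q)` -/

/-- For `‖w‖ = 1`: `‖1 - w^k‖ ≤ k ‖1 - w‖`. [folklore] -/
theorem norm_one_sub_pow_le_of_norm_one {w : ℂ} (hw : ‖w‖ = 1) (k : ℕ) :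
    ‖1 - w ^ k‖ ≤ k * ‖1 - w‖ := by
  induction k with
  | zero => simp
  | succ k ih =>
    have h : 1 - w ^ (k + 1) = (1 - w ^ k) + w ^ k * (1 - w) := by ring
    calc ‖1 - w ^ (k + 1)‖ = ‖(1 - w ^ k) + w ^ k * (1 - w)‖ := by rw [h]
      _ ≤ ‖1 - w ^ k‖ + ‖w ^ k * (1 - w)‖ := norm_add_le _ _
      _ ≤ k * ‖1 - w‖ + 1 * ‖1 - w‖ := by
          gcongr
          rw [norm_mul, norm_pow, hw, one_pow]
      _ = ((k + 1 : ℕ) : ℝ) * ‖1 - w‖ := by push_cast; ring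

/-- For `‖z‖ = 1`: `‖1 - z‖² = 2 (1 - Re z)`. [folklore] -/
theorem norm_one_sub_sq_of_norm_one {z : ℂ} (hz : ‖z‖ = 1) :
    ‖1 - z‖ ^ 2 = 2 * (1 - z.re) := by
  have h : z.re * z.re + z.im * z.im = 1 := by
    have := Complex.normSq_eq_norm_sq z
    rw [hz, one_pow, Complex.normSq_apply] at this
    exact this
  rw [← Complex.normSq_eq_norm_sq, Complex.normSq_apply]
  simp only [Complex.sub_re, Complex.one_re, Complex.sub_im, Complex.one_im, zero_sub]
  nlinarith [h]

open Complex in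
/-- **The `k`-trick, pointwise.** For a prime `p`, a Dirichlet character `χ` mod `q ≥ 1`, real
`t` and `k = 2 φ(q)`: `1 - Re p^{ikt} ≤ k² (1 + Re χ(p) p^{it})`. For `p ∤ q` this is
`|1 - v^k| ≤ k |1 - v|` applied to `v = -χ(p) p^{it}` (as `χ(p)^{φ(q)} = 1`, Euler); for `p ∣ q`
the left side is `≤ 2 ≤ k²`. [folklore] -/
theorem one_sub_re_cpow_le_totient_trick {q : ℕ} (hq : 1 ≤ q) (χ : DirichletCharacter ℂ q)
    (t : ℝ) {p : ℕ} (hp : p.Prime) :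
    1 - ((p : ℂ) ^ (((2 * q.totient : ℕ) : ℂ) * ((t : ℂ) * I))).re
      ≤ ((2 * q.totient : ℕ) : ℝ) ^ 2 * (1 + (χ p * (p : ℂ) ^ ((t : ℂ) * I)).re) := by
  have htot : 1 ≤ q.totient := Nat.totient_pos.2 hq
  have hk2 : (2 : ℝ) ≤ ((2 * q.totient : ℕ) : ℝ) := by
    have : (1 : ℝ) ≤ q.totient := by exact_mod_cast htot
    push_cast
    linarith
  have hpt : ‖(p : ℂ) ^ ((t : ℂ) * I)‖ = 1 := by
    rw [Complex.norm_natCast_cpow_of_pos hp.pos]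
    simp
  have hpk : (p : ℂ) ^ (((2 * q.totient : ℕ) : ℂ) * ((t : ℂ) * I))
      = ((p : ℂ) ^ ((t : ℂ) * I)) ^ (2 * q.totient) := cpow_nat_mul _ _ _
  have hre1 : |((p : ℂ) ^ (((2 * q.totient : ℕ) : ℂ) * ((t : ℂ) * I))).re| ≤ 1 := by
    refine (abs_re_le_norm _).trans ?_
    rw [hpk, norm_pow, hpt, one_pow]
  by_cases hu : IsUnit (p : ZMod q)
  · -- `χ(p)^{φ(q)} = 1`
    obtain ⟨u, hu'⟩ := hu
    have hχφ : χ (p : ZMod q) ^ q.totient = 1 := by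
      rw [← hu', ← map_pow, ← Units.val_pow_eq_pow_val, ZMod.pow_totient, Units.val_one, map_one]
    have hχk : χ (p : ZMod q) ^ (2 * q.totient) = 1 := by
      rw [pow_mul', hχφ, one_pow]
    have hχn : ‖χ (p : ZMod q)‖ = 1 := by rw [← hu']; exact χ.unit_norm_eq_one u
    set w : ℂ := χ p * (p : ℂ) ^ ((t : ℂ) * I) with hw
    have hwn : ‖w‖ = 1 := by rw [hw, norm_mul, hχn, hpt, one_mul]
    have hvn : ‖-w‖ = 1 := by rw [norm_neg, hwn]
    have hvk : (-w) ^ (2 * q.totient) = (p : ℂ) ^ (((2 * q.totient : ℕ) : ℂ) * ((t : ℂ) * I)) := by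
      rw [hpk, neg_pow, hw, mul_pow, hχk, one_mul, pow_mul, neg_one_sq, one_pow, one_mul]
    have h1 := norm_one_sub_pow_le_of_norm_one hvn (2 * q.totient)
    have h2 : ‖1 - (-w) ^ (2 * q.totient)‖ ^ 2 ≤ (((2 * q.totient : ℕ) : ℝ) * ‖1 - -w‖) ^ 2 := by
      gcongr
    have hvkn : ‖(-w) ^ (2 * q.totient)‖ = 1 := by rw [norm_pow, hvn, one_pow]
    rw [mul_pow, norm_one_sub_sq_of_norm_one hvkn, norm_one_sub_sq_of_norm_one hvn, hvk,
      neg_re] at h2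
    nlinarith [h2]
  · -- `χ(p) = 0`
    rw [χ.map_nonunit hu, zero_mul, Complex.zero_re, add_zero, mul_one]
    have := neg_abs_le ((p : ℂ) ^ (((2 * q.totient : ℕ) : ℂ) * ((t : ℂ) * I))).re
    nlinarith [hre1, hk2]

open Complex in
/-- **The `k`-trick.** For `q ≥ 1`, `χ` mod `q`, real `t` and `k = 2φ(q)`:
`𝔻(1, n^{ikt}; x)² ≤ k² · 𝔻(λ, χ(n) n^{it}; x)²`, summing the pointwise inequality over
`p ≤ x`. This lets a bound for `ζ` alone control `𝔻(λ, χ n^{it}; x)` for `|t| ≥ 1`. [folklore] -/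
theorem pretentiousDistSq_one_le_totient_trick {q : ℕ} (hq : 1 ≤ q)
    (χ : DirichletCharacter ℂ q) (t x : ℝ) :
    Sieve.pretentiousDistSq 1
        (Sieve.twistedChar (1 : DirichletCharacter ℂ 1) (((2 * q.totient : ℕ) : ℝ) * t)) x
      ≤ ((2 * q.totient : ℕ) : ℝ) ^ 2 *
        Sieve.pretentiousDistSq (ArithmeticFunction.liouville : ArithmeticFunction ℂ)
          (Sieve.twistedChar χ t) x := by
  rw [pretentiousDistSq_liouville_eq, Finset.mul_sum]
  unfold Sieve.pretentiousDistSq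
  refine Finset.sum_le_sum fun p hp => ?_
  have hpp := (Nat.mem_primesLE.1 hp).2
  have hp0 : (0 : ℝ) < p := by exact_mod_cast hpp.pos
  have e : ((((2 * q.totient : ℕ) : ℝ) * t : ℝ) : ℂ) * I
      = ((2 * q.totient : ℕ) : ℂ) * ((t : ℂ) * I) := by
    push_cast
    ring
  rw [Sieve.twistedChar, dirichletCharacter_modOne_apply, one_mul, Pi.one_apply, one_mul,
    Complex.conj_re, e, ← mul_div_assoc]
  exact div_le_div_of_nonneg_right (one_sub_re_cpow_le_totient_trick hq χ t hpp) hp0.le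

/-! ### Case `|t| ≥ 1`: van der Corput's bound and the `k`-trick -/

open Complex in
/-- **Case `|t| ≥ 1`.** For `q ≥ 1`, `χ` mod `q` and real `A, B` there is `x₁` such that for
`x ≥ x₁` and `1 ≤ |t| ≤ A x`: `𝔻(λ, χ(n)n^{it}; x)² ≥ B`. Indeed with `k = 2φ(q)` and `u = kt`,
`2 ≤ |u| ≤ x²`, so `𝔻(1, n^{iu}; x)² = log log x - log|ζ(σ_x - iu)| + O(1) ≥ k² B` for `x` large by
(D1c) and `log_norm_zeta_sigmaX_le`, while `𝔻(1, n^{iu}; x)² ≤ k² 𝔻(λ, χ n^{it}; x)²`. [folklore] -/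
theorem liouville_dist_large_t {q : ℕ} (hq : 1 ≤ q) (χ : DirichletCharacter ℂ q) (A B : ℝ) :
    ∃ x₁ : ℝ, ∀ x : ℝ, x₁ ≤ x → ∀ t : ℝ, 1 ≤ |t| → |t| ≤ A * x →
      B ≤ Sieve.pretentiousDistSq (ArithmeticFunction.liouville : ArithmeticFunction ℂ)
            (Sieve.twistedChar χ t) x := by
  obtain ⟨x₀, C, hx₀, hC⟩ := exists_pretentiousDistSq_one_zeta_approx
  obtain ⟨x₁, hx₁⟩ := log_norm_zeta_sigmaX_le (B * ((2 * q.totient : ℕ) : ℝ) ^ 2 + C)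
  have htot : 1 ≤ q.totient := Nat.totient_pos.2 hq
  have hk2 : (2 : ℝ) ≤ ((2 * q.totient : ℕ) : ℝ) := by
    have : (1 : ℝ) ≤ q.totient := by exact_mod_cast htot
    push_cast
    linarith
  have hkq : ((2 * q.totient : ℕ) : ℝ) ≤ 2 * q := by
    have : (q.totient : ℝ) ≤ q := by exact_mod_cast Nat.totient_le q
    push_cast
    linarith
  refine ⟨max (max x₀ x₁) (2 * q * A), fun x hx t ht1 htA => ?_⟩
  have hx0' : x₀ ≤ x := ((le_max_left _ _).trans (le_max_left _ _)).trans hx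
  have hx1' : x₁ ≤ x := ((le_max_right _ _).trans (le_max_left _ _)).trans hx
  have hx3 : 3 ≤ x := hx₀.trans hx0'
  have hxq : 2 * q * A ≤ x := (le_max_right _ _).trans hx
  have hkpos : (0 : ℝ) < ((2 * q.totient : ℕ) : ℝ) := by linarith
  set u : ℝ := ((2 * q.totient : ℕ) : ℝ) * t with hu
  have hu2 : 2 ≤ |u| := by
    rw [hu, abs_mul, abs_of_pos hkpos]
    nlinarith
  have hux : |u| ≤ x ^ 2 := by
    rw [hu, abs_mul, abs_of_pos hkpos]
    calc ((2 * q.totient : ℕ) : ℝ) * |t| ≤ (2 * q) * (A * x) :=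
          mul_le_mul hkq htA (abs_nonneg _) (by positivity)
      _ = (2 * q * A) * x := by ring
      _ ≤ x * x := by gcongr
      _ = x ^ 2 := (sq x).symm
  have h1 := hC x hx0' u
  have h2 := hx₁ x hx1' u hu2 hux
  have h3 := pretentiousDistSq_one_le_totient_trick hq χ t x
  have hlow : B * ((2 * q.totient : ℕ) : ℝ) ^ 2
      ≤ Sieve.pretentiousDistSq 1 (Sieve.twistedChar (1 : DirichletCharacter ℂ 1) u) x := by
    have := (abs_le.1 h1).1
    linarith
  have hBk := hlow.trans h3
  rw [mul_comm] at hBk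
  exact le_of_mul_le_mul_left hBk (by positivity)

/-! ### `𝔻(λ, ·)² = 2 ∑ 1/p - 𝔻(1, ·)²` and the case `|t| ≤ 1`, `χ` nontrivial -/

open Complex in
/-- `𝔻(λ, χ(n)n^{it}; x)² = 2 ∑_{p ≤ x} 1/p - 𝔻(1, χ(n)n^{it}; x)²`. [folklore] -/
theorem pretentiousDistSq_liouville_eq_two_mul_sub {q : ℕ} (χ : DirichletCharacter ℂ q)
    (t x : ℝ) :
    Sieve.pretentiousDistSq (ArithmeticFunction.liouville : ArithmeticFunction ℂ) (Sieve.twistedChar χ t) x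
      = 2 * ∑ p ∈ Nat.primesLE ⌊x⌋₊, (p : ℝ)⁻¹ - Sieve.pretentiousDistSq 1 (Sieve.twistedChar χ t) x := by
  rw [pretentiousDistSq_liouville_eq, pretentiousDistSq_one_twistedChar_eq]
  have : ∑ p ∈ Nat.primesLE ⌊x⌋₊, (1 + (χ p * (p : ℂ) ^ ((t : ℂ) * I)).re) / (p : ℝ)
      = ∑ p ∈ Nat.primesLE ⌊x⌋₊, (p : ℝ)⁻¹
        + ∑ p ∈ Nat.primesLE ⌊x⌋₊, (χ p * (p : ℂ) ^ ((t : ℂ) * I)).re / p := by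
    rw [← Finset.sum_add_distrib]
    refine Finset.sum_congr rfl fun p _ => ?_
    rw [add_div, one_div]
  rw [this]
  ring

open Complex in
/-- For a nontrivial Dirichlet character `χ`, `‖L(s, χ)‖` is bounded below by a positive constant
on the rectangle `1 ≤ Re s ≤ 2`, `|Im s| ≤ 1` (continuity of `L(·, χ)` and its non-vanishing on
`Re s ≥ 1`, both in Mathlib). [folklore] -/
theorem exists_pos_le_norm_LFunction {q : ℕ} [NeZero q] {χ : DirichletCharacter ℂ q}
    (hχ : χ ≠ 1) :
    ∃ m : ℝ, 0 < m ∧ ∀ s : ℂ, 1 ≤ s.re → s.re ≤ 2 → |s.im| ≤ 1 →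
      m ≤ ‖DirichletCharacter.LFunction χ s‖ := by
  have hK : IsCompact (Set.Icc (1 : ℝ) 2 ×ℂ Set.Icc (-1 : ℝ) 1) :=
    IsCompact.reProdIm isCompact_Icc isCompact_Icc
  have hcont : ContinuousOn (fun s => ‖DirichletCharacter.LFunction χ s‖)
      (Set.Icc (1 : ℝ) 2 ×ℂ Set.Icc (-1 : ℝ) 1) :=
    ((DirichletCharacter.differentiable_LFunction hχ).continuous.norm).continuousOn
  have hpos : ∀ s ∈ Set.Icc (1 : ℝ) 2 ×ℂ Set.Icc (-1 : ℝ) 1,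
      0 < ‖DirichletCharacter.LFunction χ s‖ := by
    intro s hs
    exact norm_pos_iff.2
      (DirichletCharacter.LFunction_ne_zero_of_one_le_re χ (Or.inl hχ) (mem_reProdIm.1 hs).1.1)
  obtain ⟨m, hm, hmle⟩ := hK.exists_forall_le' hcont hpos
  exact ⟨m, hm, fun s h1 h2 h3 => hmle s (mem_reProdIm.2 ⟨⟨h1, h2⟩, abs_le.1 h3⟩)⟩

open Complex in
/-- **Case `|t| ≤ 1`, `χ` nontrivial.** For `q ≥ 1` and `χ ≠ 1` mod `q` there are `x₁, C` with
`𝔻(λ, χ(n)n^{it}; x)² ≥ log log x - C` for `x ≥ x₁`, `|t| ≤ 1`: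
`𝔻(λ, χn^{it}; x)² = 2∑_{p ≤ x} 1/p - 𝔻(1, χn^{it}; x)² = log log x + log|L(σ_x - it, χ)| + O(1)`
and `|L(s, χ)|` is bounded below near `[1, 2]`. [folklore] -/
theorem liouville_dist_small_t_nontrivial {q : ℕ} (hq : 1 ≤ q) {χ : DirichletCharacter ℂ q}
    (hχ : χ ≠ 1) :
    ∃ x₁ C : ℝ, ∀ x : ℝ, x₁ ≤ x → ∀ t : ℝ, |t| ≤ 1 →
      Real.log (Real.log x) - C
        ≤ Sieve.pretentiousDistSq (ArithmeticFunction.liouville : ArithmeticFunction ℂ)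
            (Sieve.twistedChar χ t) x := by
  haveI : NeZero q := ⟨by omega⟩
  obtain ⟨m, hm, hmle⟩ := exists_pos_le_norm_LFunction hχ
  obtain ⟨x₀, C, hx₀, hC⟩ := exists_pretentiousDistSq_one_twistedChar_approx
  obtain ⟨x₀', C₁, hx₀', hC₁⟩ := exists_abs_sum_primesLE_inv_sub_loglog_le
  refine ⟨max x₀ x₀', 2 * C₁ + C - Real.log m, fun x hx t ht => ?_⟩
  have hx1 : x₀ ≤ x := (le_max_left _ _).trans hx
  have hx2 : x₀' ≤ x := (le_max_right _ _).trans hx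
  have hx3 : 3 ≤ x := hx₀.trans hx1
  have hσ1 : 1 < sigmaX x := one_lt_sigmaX (by linarith)
  have hσ2 : sigmaX x ≤ 2 := sigmaX_le_two (Real.exp_one_lt_three.le.trans hx3)
  set s : ℂ := (sigmaX x : ℂ) - t * I with hs
  have hsre : s.re = sigmaX x := by simp [hs]
  have hsim : s.im = -t := by simp [hs]
  have hL : LSeries (fun n : ℕ => χ n) s = DirichletCharacter.LFunction χ s :=
    (DirichletCharacter.LFunction_eq_LSeries χ (by rw [hsre]; exact hσ1)).symm
  have hlogL : Real.log m ≤ Real.log ‖LSeries (fun n : ℕ => χ n) s‖ := by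
    rw [hL]
    exact Real.log_le_log hm (hmle s (by rw [hsre]; exact hσ1.le) (by rw [hsre]; exact hσ2)
      (by rw [hsim, abs_neg]; exact ht))
  have h1 := (abs_le.1 (hC x hx1 q χ t)).2
  have h2 := (abs_le.1 (hC₁ x hx2)).1
  rw [pretentiousDistSq_liouville_eq_two_mul_sub]
  linarith

/-! ### Case `|t| ≤ 1`, principal characters: reduction to `ζ` -/

open Complex in
/-- `Re p^{it} = cos(t log p)`. [folklore] -/
theorem re_natCast_cpow_mul_I {p : ℕ} (hp : 0 < p) (t : ℝ) :
    ((p : ℂ) ^ ((t : ℂ) * I)).re = Real.cos (t * Real.log p) := by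
  have hp0 : (p : ℂ) ≠ 0 := by exact_mod_cast hp.ne'
  rw [Complex.cpow_def_of_ne_zero hp0, show (p : ℂ) = ((p : ℝ) : ℂ) by norm_cast,
    ← Complex.ofReal_log (Nat.cast_nonneg p)]
  have : ((Real.log p : ℝ) : ℂ) * ((t : ℂ) * I) = ((t * Real.log p : ℝ) : ℂ) * I := by
    push_cast
    ring
  rw [this, Complex.exp_ofReal_mul_I_re]

open Complex in
/-- **Case `q = 1`, `|t| ≤ (log x)^{-1/2}`.** For primes `p ≤ y = exp(√log x)` one has
`|t log p| ≤ 1`, so `Re p^{it} = cos(t log p) ≥ 0`, whence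
`𝔻(λ, n^{it}; x)² ≥ ∑_{p ≤ y} 1/p ≥ log log y - O(1) = ½ log log x - O(1)`. [folklore] -/
theorem liouville_dist_tiny_t :
    ∃ x₁ C : ℝ, ∀ x : ℝ, x₁ ≤ x → ∀ t : ℝ, |t| * Real.sqrt (Real.log x) ≤ 1 →
      1 / 2 * Real.log (Real.log x) - C
        ≤ Sieve.pretentiousDistSq (ArithmeticFunction.liouville : ArithmeticFunction ℂ)
            (Sieve.twistedChar (1 : DirichletCharacter ℂ 1) t) x := by
  obtain ⟨x₀, C₁, hx₀, hC₁⟩ := exists_abs_sum_primesLE_inv_sub_loglog_le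
  refine ⟨max 3 (Real.exp (Real.log x₀ ^ 2)), C₁, fun x hx t ht => ?_⟩
  have hx3 : 3 ≤ x := (le_max_left _ _).trans hx
  have hx0 : 0 < x := by linarith
  have hlogx : 1 ≤ Real.log x := one_le_log_of_exp_le (Real.exp_one_lt_three.le.trans hx3)
  have hx₀pos : 0 < x₀ := by linarith
  set y : ℝ := Real.exp (Real.sqrt (Real.log x)) with hy
  have hyx₀ : x₀ ≤ y := by
    have h1 : Real.log x₀ ^ 2 ≤ Real.log x := by
      rw [← Real.log_exp (Real.log x₀ ^ 2)]
      exact Real.log_le_log (Real.exp_pos _) ((le_max_right _ _).trans hx)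
    have h2 : Real.log x₀ ≤ Real.sqrt (Real.log x) := by
      rw [← Real.sqrt_sq (Real.log_nonneg (by linarith : (1 : ℝ) ≤ x₀))]
      exact Real.sqrt_le_sqrt h1
    calc x₀ = Real.exp (Real.log x₀) := (Real.exp_log hx₀pos).symm
      _ ≤ y := Real.exp_le_exp.2 h2
  have hyx : y ≤ x := by
    have : Real.sqrt (Real.log x) ≤ Real.log x := by
      calc Real.sqrt (Real.log x) ≤ Real.sqrt (Real.log x ^ 2) :=
            Real.sqrt_le_sqrt (by nlinarith)
        _ = Real.log x := Real.sqrt_sq (by linarith)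
    calc y ≤ Real.exp (Real.log x) := Real.exp_le_exp.2 this
      _ = x := Real.exp_log hx0
  have hloglogy : Real.log (Real.log y) = 1 / 2 * Real.log (Real.log x) := by
    rw [hy, Real.log_exp, Real.log_sqrt (by linarith)]
    ring
  have h1 := (abs_le.1 (hC₁ y hyx₀)).1
  rw [pretentiousDistSq_liouville_eq]
  have hsub : Nat.primesLE ⌊y⌋₊ ⊆ Nat.primesLE ⌊x⌋₊ := fun p hp => by
    rw [Nat.mem_primesLE] at hp ⊢
    exact ⟨hp.1.trans (Nat.floor_le_floor hyx), hp.2⟩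
  have hmain : ∀ p ∈ Nat.primesLE ⌊y⌋₊, (p : ℝ)⁻¹
      ≤ (1 + ((1 : DirichletCharacter ℂ 1) p * (p : ℂ) ^ ((t : ℂ) * I)).re) / (p : ℝ) := by
    intro p hp
    obtain ⟨hpy, hpp⟩ := Nat.mem_primesLE.1 hp
    have hp0 : (0 : ℝ) < p := by exact_mod_cast hpp.pos
    rw [dirichletCharacter_modOne_apply, one_mul, re_natCast_cpow_mul_I hpp.pos]
    have hlogp : Real.log p ≤ Real.sqrt (Real.log x) := by
      have : (p : ℝ) ≤ y := le_trans (by exact_mod_cast hpy) (Nat.floor_le (Real.exp_pos _).le)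
      rw [← Real.log_exp (Real.sqrt _)]
      exact Real.log_le_log hp0 this
    have hlogp0 : 0 ≤ Real.log p := Real.log_nonneg (by exact_mod_cast hpp.one_lt.le)
    have habs : |t * Real.log p| ≤ 1 := by
      rw [abs_mul, abs_of_nonneg hlogp0]
      calc |t| * Real.log p ≤ |t| * Real.sqrt (Real.log x) := by gcongr
        _ ≤ 1 := ht
    have hcos : 0 ≤ Real.cos (t * Real.log p) :=
      Real.cos_nonneg_of_neg_pi_div_two_le_of_le
        (by linarith [(abs_le.1 habs).1, Real.pi_gt_three])
        (by linarith [(abs_le.1 habs).2, Real.pi_gt_three])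
    rw [inv_eq_one_div]
    gcongr
    linarith
  calc 1 / 2 * Real.log (Real.log x) - C₁ = Real.log (Real.log y) - C₁ := by rw [hloglogy]
    _ ≤ ∑ p ∈ Nat.primesLE ⌊y⌋₊, (p : ℝ)⁻¹ := by linarith
    _ ≤ ∑ p ∈ Nat.primesLE ⌊y⌋₊,
          (1 + ((1 : DirichletCharacter ℂ 1) p * (p : ℂ) ^ ((t : ℂ) * I)).re) / (p : ℝ) :=
        Finset.sum_le_sum hmain
    _ ≤ ∑ p ∈ Nat.primesLE ⌊x⌋₊,
          (1 + ((1 : DirichletCharacter ℂ 1) p * (p : ℂ) ^ ((t : ℂ) * I)).re) / (p : ℝ) :=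
        Finset.sum_le_sum_of_subset_of_nonneg hsub fun p hp _ =>
          (liouville_pretentious_summand_mem (1 : DirichletCharacter ℂ 1) t
            (Nat.mem_primesLE.1 hp).2).1

open Complex in
/-- **Mertens' `3-4-1` at `σ_x`.** There are `x₁ ≥ 3` and `C` such that for `x ≥ x₁` and
`(log x)^{-1/2} < |y| ≤ 1`: `log |ζ(σ_x + iy)| ≥ -(7/8) log log x - C`. From
`|ζ(σ)³ ζ(σ+iy)⁴ ζ(σ+2iy)| ≥ 1` (Mathlib, `DirichletCharacter.norm_LSeries_product_ge_one`),
`ζ(σ_x) ≤ 2 log x` and `|ζ(σ_x + 2iy)| ≤ 1/(2|y|) + O(1) ≤ (1/2 + O(1)) (log x)^{1/2}`.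
[folklore] -/
theorem exists_log_norm_zeta_sigmaX_ge :
    ∃ x₁ C : ℝ, 3 ≤ x₁ ∧ ∀ x : ℝ, x₁ ≤ x → ∀ y : ℝ, 1 < |y| * Real.sqrt (Real.log x) →
      |y| ≤ 1 →
      -(7 / 8) * Real.log (Real.log x) - C
        ≤ Real.log ‖riemannZeta ((sigmaX x : ℂ) + y * I)‖ := by
  obtain ⟨M, hM0, hM⟩ := exists_bound_riemannZeta_sub_inv
  refine ⟨max 3 (Real.exp (2 * M + 2)), (3 * Real.log 2 + Real.log (1 / 2 + M)) / 4,
    le_max_left _ _, fun x hx y hy1 hy2 => ?_⟩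
  have hx3 : 3 ≤ x := (le_max_left _ _).trans hx
  have hx1 : 1 < x := by linarith
  have hlogx : 2 * M + 2 ≤ Real.log x := by
    rw [← Real.log_exp (2 * M + 2)]
    exact Real.log_le_log (Real.exp_pos _) ((le_max_right _ _).trans hx)
  have hlogx1 : 1 ≤ Real.log x := by linarith
  have hlogpos : 0 < Real.log x := by linarith
  have hsq1 : 1 ≤ Real.sqrt (Real.log x) := by
    rw [← Real.sqrt_one]
    exact Real.sqrt_le_sqrt hlogx1
  have hσ1 : 1 < sigmaX x := one_lt_sigmaX hx1
  have hσ2 : sigmaX x ≤ 2 := sigmaX_le_two (Real.exp_one_lt_three.le.trans hx3)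
  have hy0 : 0 < |y| := by
    rcases (abs_nonneg y).eq_or_lt with h | h
    · rw [← h, zero_mul] at hy1
      linarith
    · exact h
  -- (i) the 3-4-1 inequality
  have h341 : 1 ≤ ‖riemannZeta (sigmaX x : ℂ)‖ ^ 3 * ‖riemannZeta ((sigmaX x : ℂ) + y * I)‖ ^ 4
      * ‖riemannZeta ((sigmaX x : ℂ) + 2 * y * I)‖ := by
    have h := DirichletCharacter.norm_LSeries_product_ge_one (N := 1)
      (1 : DirichletCharacter ℂ 1) (one_div_pos.2 hlogpos) y
    have e0 : (1 : ℂ) + ((1 / Real.log x : ℝ) : ℂ) = (sigmaX x : ℂ) := by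
      rw [sigmaX]
      push_cast
      ring
    have h₀ : 1 < ((sigmaX x : ℂ)).re := by simpa using hσ1
    have h₁ : 1 < ((sigmaX x : ℂ) + I * y).re := by simpa using hσ1
    have h₂ : 1 < ((sigmaX x : ℂ) + 2 * I * y).re := by simpa using hσ1
    rw [one_pow, e0, DirichletCharacter.LSeries_modOne_eq, LSeries_one_eq_riemannZeta h₀,
      LSeries_one_eq_riemannZeta h₁, LSeries_one_eq_riemannZeta h₂, norm_mul, norm_mul,
      norm_pow, norm_pow] at h
    have e1 : (sigmaX x : ℂ) + I * y = (sigmaX x : ℂ) + y * I := by ring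
    have e2 : (sigmaX x : ℂ) + 2 * I * y = (sigmaX x : ℂ) + 2 * y * I := by ring
    rw [e1, e2] at h
    exact h
  -- (ii) upper bounds for `ζ(σ_x)` and `ζ(σ_x + 2iy)`
  have hne1 : (sigmaX x : ℂ) ≠ 1 := by
    intro h
    have := congrArg Complex.re h
    simp only [ofReal_re, one_re] at this
    linarith
  have hζ0 : ‖riemannZeta (sigmaX x : ℂ)‖ ≤ 2 * Real.log x := by
    have h := hM (sigmaX x : ℂ) (by simpa using hσ1.le) (by simpa using hσ2) (by simp) hne1
    rw [sigmaX_sub_one_inv hx1] at h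
    have := norm_le_insert' (riemannZeta (sigmaX x : ℂ)) (Real.log x : ℂ)
    rw [Complex.norm_real, Real.norm_of_nonneg hlogpos.le] at this
    linarith
  set s₂ : ℂ := (sigmaX x : ℂ) + 2 * y * I with hs₂
  have hs₂re : s₂.re = sigmaX x := by simp [hs₂]
  have hs₂im : s₂.im = 2 * y := by simp [hs₂]
  have hs₂ne : s₂ ≠ 1 := by
    intro h
    have := congrArg Complex.im h
    rw [hs₂im, one_im] at this
    have hy : y = 0 := by linarith
    rw [hy, abs_zero] at hy0
    exact lt_irrefl _ hy0
  have hζ2 : ‖riemannZeta s₂‖ ≤ Real.sqrt (Real.log x) * (1 / 2 + M) := by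
    have h := hM s₂ (by rw [hs₂re]; exact hσ1.le) (by rw [hs₂re]; exact hσ2)
      (by rw [hs₂im, abs_mul, abs_two]; linarith) hs₂ne
    have hinv : ‖(s₂ - 1)⁻¹‖ ≤ Real.sqrt (Real.log x) / 2 := by
      rw [norm_inv]
      have him : |(s₂ - 1).im| ≤ ‖s₂ - 1‖ := Complex.abs_im_le_norm _
      rw [sub_im, one_im, sub_zero, hs₂im, abs_mul, abs_two] at him
      have h2y : 0 < 2 * |y| := by positivity
      calc ‖s₂ - 1‖⁻¹ ≤ (2 * |y|)⁻¹ := inv_anti₀ h2y him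
        _ = 1 / (2 * |y|) := inv_eq_one_div _
        _ ≤ Real.sqrt (Real.log x) / 2 := by
            rw [div_le_div_iff₀ h2y two_pos]
            nlinarith
    have := norm_le_insert' (riemannZeta s₂) ((s₂ - 1)⁻¹)
    nlinarith
  -- (iii) logarithms
  have hζ0pos : 0 < ‖riemannZeta (sigmaX x : ℂ)‖ :=
    norm_pos_iff.2 (riemannZeta_ne_zero_of_one_lt_re (by simpa using hσ1))
  have hζ1pos : 0 < ‖riemannZeta ((sigmaX x : ℂ) + y * I)‖ :=
    norm_pos_iff.2 (riemannZeta_ne_zero_of_one_lt_re (by simpa using hσ1))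
  have hζ2pos : 0 < ‖riemannZeta s₂‖ :=
    norm_pos_iff.2 (riemannZeta_ne_zero_of_one_lt_re (by rw [hs₂re]; exact hσ1))
  have hlog341 := Real.log_nonneg h341
  rw [Real.log_mul (mul_pos (pow_pos hζ0pos 3) (pow_pos hζ1pos 4)).ne' hζ2pos.ne',
    Real.log_mul (pow_pos hζ0pos 3).ne' (pow_pos hζ1pos 4).ne', Real.log_pow,
    Real.log_pow] at hlog341
  have hla : Real.log ‖riemannZeta (sigmaX x : ℂ)‖ ≤ Real.log 2 + Real.log (Real.log x) := by
    rw [← Real.log_mul two_ne_zero hlogpos.ne']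
    exact Real.log_le_log hζ0pos hζ0
  have hlc : Real.log ‖riemannZeta s₂‖
      ≤ 1 / 2 * Real.log (Real.log x) + Real.log (1 / 2 + M) := by
    have h12M : 0 < 1 / 2 + M := by linarith
    calc Real.log ‖riemannZeta s₂‖ ≤ Real.log (Real.sqrt (Real.log x) * (1 / 2 + M)) :=
          Real.log_le_log hζ2pos hζ2
      _ = 1 / 2 * Real.log (Real.log x) + Real.log (1 / 2 + M) := by
          rw [Real.log_mul (by positivity) h12M.ne', Real.log_sqrt hlogpos.le]
          ring
  push_cast at hlog341
  linarith

open Complex in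
/-- **Case `q = 1`, `(log x)^{-1/2} < |t| ≤ 1`.** `𝔻(λ, n^{it}; x)² ≥ (1/8) log log x - C` for
`x ≥ x₁`: `𝔻(λ, n^{it}; x)² = log log x + log |ζ(σ_x - it)| + O(1)` ((D1c) and Mertens) and the
`3-4-1` bound. [folklore] -/
theorem liouville_dist_medium_t :
    ∃ x₁ C : ℝ, ∀ x : ℝ, x₁ ≤ x → ∀ t : ℝ, 1 < |t| * Real.sqrt (Real.log x) → |t| ≤ 1 →
      1 / 8 * Real.log (Real.log x) - C
        ≤ Sieve.pretentiousDistSq (ArithmeticFunction.liouville : ArithmeticFunction ℂ)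
            (Sieve.twistedChar (1 : DirichletCharacter ℂ 1) t) x := by
  obtain ⟨x₁, C', hx₁, hC'⟩ := exists_log_norm_zeta_sigmaX_ge
  obtain ⟨x₀, C, hx₀, hC⟩ := exists_pretentiousDistSq_one_zeta_approx
  obtain ⟨x₀', C₁, hx₀', hC₁⟩ := exists_abs_sum_primesLE_inv_sub_loglog_le
  refine ⟨max x₁ (max x₀ x₀'), 2 * C₁ + C + C', fun x hx t ht1 ht2 => ?_⟩
  have hxa : x₁ ≤ x := (le_max_left _ _).trans hx
  have hxb : x₀ ≤ x := (le_max_left _ _).trans ((le_max_right _ _).trans hx)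
  have hxc : x₀' ≤ x := (le_max_right _ _).trans ((le_max_right _ _).trans hx)
  have h1 := (abs_le.1 (hC x hxb t)).2
  have h2 := (abs_le.1 (hC₁ x hxc)).1
  have h3 := hC' x hxa (-t) (by rwa [abs_neg]) (by rwa [abs_neg])
  have e : (sigmaX x : ℂ) + ((-t : ℝ) : ℂ) * I = (sigmaX x : ℂ) - t * I := by
    push_cast
    ring
  rw [e] at h3
  rw [pretentiousDistSq_liouville_eq_two_mul_sub]
  linarith

/-- **Case `q = 1`, `|t| ≤ 1`.** `𝔻(λ, n^{it}; x)² ≥ (1/8) log log x - C` for `x ≥ x₁`.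
[folklore] -/
theorem liouville_dist_small_t_modOne :
    ∃ x₁ C : ℝ, ∀ x : ℝ, x₁ ≤ x → ∀ t : ℝ, |t| ≤ 1 →
      1 / 8 * Real.log (Real.log x) - C
        ≤ Sieve.pretentiousDistSq (ArithmeticFunction.liouville : ArithmeticFunction ℂ)
            (Sieve.twistedChar (1 : DirichletCharacter ℂ 1) t) x := by
  obtain ⟨x₁, C₁, h₁⟩ := liouville_dist_tiny_t
  obtain ⟨x₂, C₂, h₂⟩ := liouville_dist_medium_t
  refine ⟨max 3 (max x₁ x₂), max C₁ C₂, fun x hx t ht => ?_⟩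
  have hx3 : 3 ≤ x := (le_max_left _ _).trans hx
  have hxa : x₁ ≤ x := (le_max_left _ _).trans ((le_max_right _ _).trans hx)
  have hxb : x₂ ≤ x := (le_max_right _ _).trans ((le_max_right _ _).trans hx)
  have hLL : 0 ≤ Real.log (Real.log x) := Real.log_nonneg (one_le_log_of_exp_le (Real.exp_one_lt_three.le.trans hx3))
  rcases le_or_gt (|t| * Real.sqrt (Real.log x)) 1 with h | h
  · have := h₁ x hxa t h
    linarith [le_max_left C₁ C₂]
  · have := h₂ x hxb t h ht
    linarith [le_max_right C₁ C₂]

open Complex in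
/-- For the principal character `χ₀` mod `q ≥ 1`: `𝔻(λ, χ₀(n)n^{it}; x)² ≥ 𝔻(λ, n^{it}; x)² - q`
(the sums agree at primes `p ∤ q`; the at most `q` primes `p ∣ q` contribute terms in `[0, 1]`).
[folklore] -/
theorem pretentiousDistSq_liouville_principal_ge {q : ℕ} (hq : 1 ≤ q) (t x : ℝ) :
    Sieve.pretentiousDistSq (ArithmeticFunction.liouville : ArithmeticFunction ℂ)
        (Sieve.twistedChar (1 : DirichletCharacter ℂ 1) t) x - q
      ≤ Sieve.pretentiousDistSq (ArithmeticFunction.liouville : ArithmeticFunction ℂ)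
        (Sieve.twistedChar (1 : DirichletCharacter ℂ q) t) x := by
  rw [pretentiousDistSq_liouville_eq, pretentiousDistSq_liouville_eq,
    ← Finset.sum_filter_add_sum_filter_not (Nat.primesLE ⌊x⌋₊) (fun p => p ∣ q)
      (fun p => (1 + ((1 : DirichletCharacter ℂ 1) p * (p : ℂ) ^ ((t : ℂ) * I)).re) / (p : ℝ)),
    ← Finset.sum_filter_add_sum_filter_not (Nat.primesLE ⌊x⌋₊) (fun p => p ∣ q)
      (fun p => (1 + ((1 : DirichletCharacter ℂ q) p * (p : ℂ) ^ ((t : ℂ) * I)).re) / (p : ℝ))]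
  have hA : ∑ p ∈ (Nat.primesLE ⌊x⌋₊).filter (fun p => p ∣ q),
      (1 + ((1 : DirichletCharacter ℂ 1) p * (p : ℂ) ^ ((t : ℂ) * I)).re) / (p : ℝ) ≤ q := by
    calc ∑ p ∈ (Nat.primesLE ⌊x⌋₊).filter (fun p => p ∣ q),
          (1 + ((1 : DirichletCharacter ℂ 1) p * (p : ℂ) ^ ((t : ℂ) * I)).re) / (p : ℝ)
        ≤ ∑ _p ∈ (Nat.primesLE ⌊x⌋₊).filter (fun p => p ∣ q), (1 : ℝ) := by
          refine Finset.sum_le_sum fun p hp => ?_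
          have hpp : p.Prime := (Nat.mem_primesLE.1 (Finset.mem_filter.1 hp).1).2
          have hp2 : (2 : ℝ) ≤ p := by exact_mod_cast hpp.two_le
          refine (liouville_pretentious_summand_mem (1 : DirichletCharacter ℂ 1) t hpp).2.trans ?_
          rw [div_le_one (by linarith)]
          exact hp2
      _ = (((Nat.primesLE ⌊x⌋₊).filter (fun p => p ∣ q)).card : ℝ) := by
          rw [Finset.sum_const, nsmul_eq_mul, mul_one]
      _ ≤ (q.divisors.card : ℝ) := by
          have : (Nat.primesLE ⌊x⌋₊).filter (fun p => p ∣ q) ⊆ q.divisors := by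
            intro p hp
            rw [Finset.mem_filter] at hp
            exact Nat.mem_divisors.2 ⟨hp.2, by omega⟩
          exact_mod_cast Finset.card_le_card this
      _ ≤ q := by exact_mod_cast Nat.card_divisors_le_self q
  have hB : ∑ p ∈ (Nat.primesLE ⌊x⌋₊).filter (fun p => ¬p ∣ q),
      (1 + ((1 : DirichletCharacter ℂ 1) p * (p : ℂ) ^ ((t : ℂ) * I)).re) / (p : ℝ)
        = ∑ p ∈ (Nat.primesLE ⌊x⌋₊).filter (fun p => ¬p ∣ q),
      (1 + ((1 : DirichletCharacter ℂ q) p * (p : ℂ) ^ ((t : ℂ) * I)).re) / (p : ℝ) := by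
    refine Finset.sum_congr rfl fun p hp => ?_
    rw [Finset.mem_filter] at hp
    have hpp : p.Prime := (Nat.mem_primesLE.1 hp.1).2
    rw [dirichletCharacter_modOne_apply,
      MulChar.one_apply ((ZMod.isUnit_prime_iff_not_dvd hpp).2 hp.2)]
  have hA' : 0 ≤ ∑ p ∈ (Nat.primesLE ⌊x⌋₊).filter (fun p => p ∣ q),
      (1 + ((1 : DirichletCharacter ℂ q) p * (p : ℂ) ^ ((t : ℂ) * I)).re) / (p : ℝ) :=
    Finset.sum_nonneg fun p hp =>
      (liouville_pretentious_summand_mem (1 : DirichletCharacter ℂ q) t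
        (Nat.mem_primesLE.1 (Finset.mem_filter.1 hp).1).2).1
  linarith

/-! ### Assembly: `λ` is non-pretentious (Tao 2016, hypothesis (1.6)) -/

open Filter in
/-- **All cases together, per character.** For `q ≥ 1`, `χ` mod `q` and real `A, B`: for all
large `x`, `𝔻(λ, χ(n)n^{it}; x)² ≥ B` for every `|t| ≤ A x`. (Cases: `|t| ≥ 1` via van der
Corput's bound and the `k`-trick; `|t| ≤ 1`, `χ ≠ χ₀` via `L(s, χ) ≠ 0` near `[1,2]`; `|t| ≤ 1`,
`χ = χ₀` via `ζ(s) ~ 1/(s-1)` and `3-4-1`.) [folklore] -/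
theorem liouville_dist_eventually_ge {q : ℕ} (hq : 1 ≤ q) (χ : DirichletCharacter ℂ q)
    (A B : ℝ) :
    ∀ᶠ x : ℝ in atTop, ∀ t : ℝ, |t| ≤ A * x →
      B ≤ Sieve.pretentiousDistSq (ArithmeticFunction.liouville : ArithmeticFunction ℂ)
        (Sieve.twistedChar χ t) x := by
  obtain ⟨xL, hL⟩ := liouville_dist_large_t hq χ A B
  obtain ⟨xP, CP, hP⟩ := liouville_dist_small_t_modOne
  have hLL : Tendsto (fun x : ℝ => Real.log (Real.log x)) atTop atTop :=
    Real.tendsto_log_atTop.comp Real.tendsto_log_atTop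
  by_cases hχ : χ = 1
  · subst hχ
    have eP : ∀ᶠ x : ℝ in atTop, 8 * (B + CP + q) ≤ Real.log (Real.log x) :=
      hLL.eventually (eventually_ge_atTop _)
    filter_upwards [eP, eventually_ge_atTop xL, eventually_ge_atTop xP] with x h2 h3 h4
    intro t ht
    rcases le_or_gt 1 |t| with ht1 | ht1
    · exact hL x h3 t ht1 ht
    · have h5 := hP x h4 t ht1.le
      have h6 := pretentiousDistSq_liouville_principal_ge hq t x
      linarith
  · obtain ⟨xN, CN, hN⟩ := liouville_dist_small_t_nontrivial hq hχ
    have eN : ∀ᶠ x : ℝ in atTop, B + CN ≤ Real.log (Real.log x) :=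
      hLL.eventually (eventually_ge_atTop _)
    filter_upwards [eN, eventually_ge_atTop xL, eventually_ge_atTop xN] with x h2 h3 h4
    intro t ht
    rcases le_or_gt 1 |t| with ht1 | ht1
    · exact hL x h3 t ht1 ht
    · have h5 := hN x h4 t ht1.le
      linarith

open Filter in
/-- **DISCHARGE of `Literature.NumberTheory.LFunctions.Tao2016_liouvilleNonpretentious`: `λ` satisfies Tao's hypothesis (1.6) at
every level.** Finitely many characters of modulus `≤ A` and `liouville_dist_eventually_ge`.
Tao (2016, §1 after Remark 1.6) attributes this to the Vinogradov–Korobov zero-free region; the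
present proof uses only van der Corput's `ζ(σ + it) = o(log t)` (`1 < σ ≤ 2`) together with the
elementary `k`-trick, `3-4-1`, and the non-vanishing of `L(s, χ)` on `Re s ≥ 1` (Mathlib).
[cite: TaoFMP2016, §1 after Remark 1.6 (hypotheses (1.6)/(1.8) for λ)] -/
theorem Tao2016_liouvilleNonpretentious_holds : Tao2016_liouvilleNonpretentious := by
  intro A
  rcases lt_or_ge A 1 with hA | hA
  · exact Eventually.of_forall fun x q χ t hq hqA _ =>
      absurd hqA (not_le.2 (hA.trans_le (by exact_mod_cast hq)))
  · have key : ∀ q ∈ Finset.Icc 1 ⌊A⌋₊, ∀ᶠ x : ℝ in atTop,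
        ∀ (χ : DirichletCharacter ℂ q) (t : ℝ), |t| ≤ A * x →
          A ≤ Sieve.pretentiousDistSq (ArithmeticFunction.liouville : ArithmeticFunction ℂ)
            (Sieve.twistedChar χ t) x := by
      intro q hq
      have hq1 : 1 ≤ q := (Finset.mem_Icc.1 hq).1
      exact eventually_all.2 fun χ => liouville_dist_eventually_ge hq1 χ A A
    filter_upwards [(eventually_all_finset (Finset.Icc 1 ⌊A⌋₊)).2 key] with x hx q χ t hq hqA ht
    exact hx q (Finset.mem_Icc.2 ⟨hq, Nat.le_floor hqA⟩) χ t ht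

/-- **Tao 2016, Theorem 1.3 ⇒ Theorem 1.2 (parity.S21), unconditionally in the second
hypothesis.** `Literature.NumberTheory.Sieve.tao_log_chowla_liouville` follows from the log-averaged Elliott theorem
`Literature.NumberTheory.LFunctions.tao_log_averaged_elliott_two` (Tao 2016, Thm 1.3) alone.
[cite: TaoFMP2016, Theorem 1.2 (deduction from Theorem 1.3: §1 after Remark 1.6, and §2)] -/
theorem tao_log_chowla_liouville_of_elliott_two (hE : tao_log_averaged_elliott_two) :
    Sieve.tao_log_chowla_liouville :=
  LFunctions.tao_log_chowla_liouville_of_elliott hE Tao2016_liouvilleNonpretentious_holds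

open Filter in
/-- **DISCHARGE of `Literature.NumberTheory.Sieve.isNonpretentious_liouville`** (per-character `M_χ(λ; x) → ∞`,
`PretentiousDistance`; Matomäki–Radziwiłł–Tao 2015, §1, discussion after Conjecture 1.5).
[cite: MatomakiRadziwillTao2015, §1 (discussion after Conjecture 1.5, eq. (1.12))] -/
theorem isNonpretentious_liouville_holds : Sieve.isNonpretentious_liouville := by
  intro q _ χ
  have hfun : (fun n ↦ (ArithmeticFunction.liouville n : ℂ))
      = ⇑(ArithmeticFunction.liouville : ArithmeticFunction ℂ) := by
    funext n
    simp [ArithmeticFunction.intCoe_apply]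
  have hq1 : 1 ≤ q := NeZero.one_le
  refine tendsto_atTop.2 fun B => ?_
  filter_upwards [liouville_dist_eventually_ge hq1 χ 1 B, eventually_ge_atTop 0] with x hx hx0
  have hne : Nonempty (Set.Icc (-x) x) := ⟨⟨0, by simp [hx0]⟩⟩
  rw [hfun]
  refine le_ciInf fun t => ?_
  have ht : |(t : ℝ)| ≤ 1 * x := by
    rw [one_mul]
    exact abs_le.2 t.2
  exact hx t ht

/-- `μ` and `λ` agree at primes, so their pretentious distances to any `g` coincide.
[folklore] -/
theorem pretentiousDistSq_moebius_fun_eq_liouville (g : ℕ → ℂ) (x : ℝ) :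
    Sieve.pretentiousDistSq (fun n => (ArithmeticFunction.moebius n : ℂ)) g x
      = Sieve.pretentiousDistSq (ArithmeticFunction.liouville : ArithmeticFunction ℂ) g x := by
  unfold Sieve.pretentiousDistSq
  refine Finset.sum_congr rfl fun p hp => ?_
  have hpp := (Nat.mem_primesLE.1 hp).2
  dsimp only
  rw [ArithmeticFunction.moebius_apply_prime hpp, liouville_complex_apply_prime hpp]
  push_cast
  ring

open Filter in
/-- **DISCHARGE of `Literature.NumberTheory.Sieve.isNonpretentious_moebius`** (Matomäki–Radziwiłł–Tao 2015, §1: `μ` agrees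
with `λ` at primes). [cite: MatomakiRadziwillTao2015, §1 (discussion after Conjecture 1.5)] -/
theorem isNonpretentious_moebius_holds : Sieve.isNonpretentious_moebius := by
  intro q _ χ
  have h := isNonpretentious_liouville_holds q χ
  have hfun : (fun n ↦ (ArithmeticFunction.liouville n : ℂ))
      = ⇑(ArithmeticFunction.liouville : ArithmeticFunction ℂ) := by
    funext n
    simp [ArithmeticFunction.intCoe_apply]
  have hcn : (fun x : ℝ =>
      Sieve.charNonpretentiousness (fun n ↦ (ArithmeticFunction.moebius n : ℂ)) χ x)
        = fun x => Sieve.charNonpretentiousness (fun n ↦ (ArithmeticFunction.liouville n : ℂ)) χ x := by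
    funext x
    unfold Sieve.charNonpretentiousness
    congr 1
    funext t
    rw [pretentiousDistSq_moebius_fun_eq_liouville, hfun]
  rw [hcn]
  exact h

/-! ### parity.S21 from Tao's Theorem 2.3 — the route for `λ` (Tao 2016, §2) -/

/-- The complex Liouville function is completely multiplicative. [folklore] -/
theorem liouville_complex_apply_mul (m n : ℕ) :
    (ArithmeticFunction.liouville : ArithmeticFunction ℂ) (m * n)
      = (ArithmeticFunction.liouville : ArithmeticFunction ℂ) m
        * (ArithmeticFunction.liouville : ArithmeticFunction ℂ) n := by
  simp only [ArithmeticFunction.intCoe_apply, ArithmeticFunction.liouville_apply_mul, Int.cast_mul]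

/-- `|λ(n)| = 1` for `n ≥ 1` (as a complex number). [folklore] -/
theorem norm_liouville_complex_eq_one {n : ℕ} (hn : 1 ≤ n) :
    ‖(ArithmeticFunction.liouville : ArithmeticFunction ℂ) n‖ = 1 := by
  rw [ArithmeticFunction.intCoe_apply, ArithmeticFunction.liouville_apply (by omega)]
  simp

open Filter Asymptotics in
/-- **Tao 2016, Theorem 2.3 ⇒ Theorem 1.2 (parity.S21), directly for `λ`.** As the paper says
(§2, first paragraph), for the Liouville function one may "skip the initial reductions and move
directly to Theorem 2.3": `λ` is completely multiplicative with `|λ| = 1`, and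
`λ(a₁n + b₁) λ(a₂n + b₂) = λ(a₁) λ(a₂) · λ(a n + b) λ(a n + b + h)` with `a = a₁a₂`, `b = a₂b₁`,
`h = a₁b₂ - a₂b₁ ≠ 0` (§2, before Theorem 2.3). Given `c > 0`, apply Theorem 2.3 with `ε = c/4`
and `ω = x / log x` (so `x/ω = log x`, allowed by the strengthened range `A ≤ ω ≤ x / log x`); its
hypothesis (2.2) for `g₁ = λ` at level `A` holds for large `x` by
`Tao2016_liouvilleNonpretentious_holds`. The tail `log x < n ≤ x` then contributes at most
`(c/4) log x`, and the head `n ≤ log x` at most `∑_{n ≤ log x} 1/n ≤ 1 + log log x = o(log x)`.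
[cite: TaoFMP2016, Theorem 1.2 via Theorem 2.3 (§2: first paragraph and the two paragraphs before Theorem 2.3)] -/
theorem tao_log_chowla_liouville_of_theorem23 (h23 : Tao2016_theorem23) :
    Sieve.tao_log_chowla_liouville := by
  intro a₁ a₂ b₁ b₂ ha₁ ha₂ hab
  refine Asymptotics.isLittleO_iff.2 fun c hc => ?_
  set L : ArithmeticFunction ℂ := (ArithmeticFunction.liouville : ArithmeticFunction ℂ) with hL
  -- the parameters `a = a₁a₂`, `b = a₂b₁`, `h = a₁b₂ - a₂b₁` of Theorem 2.3
  have ha : 1 ≤ a₁ * a₂ := Nat.one_le_iff_ne_zero.2 (Nat.mul_ne_zero (by omega) (by omega))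
  have hh : ((a₁ * b₂ : ℕ) : ℤ) - ((a₂ * b₁ : ℕ) : ℤ) ≠ 0 := by
    intro h0
    exact hab (by exact_mod_cast (sub_eq_zero.1 h0))
  obtain ⟨A₀, hA₀⟩ := h23 (a₁ * a₂) ((a₂ * b₁ : ℕ) : ℤ) (((a₁ * b₂ : ℕ) : ℤ) - ((a₂ * b₁ : ℕ) : ℤ))
    ha hh (c / 4) (by positivity)
  set A : ℝ := max A₀ 1 with hA
  have hA1 : 1 ≤ A := le_max_right _ _
  have hA0 : 0 < A := by linarith
  -- eventualities along `x : ℕ → ∞`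
  have hlog : Tendsto (fun x : ℕ => Real.log (x : ℝ)) atTop atTop :=
    Real.tendsto_log_atTop.comp tendsto_natCast_atTop_atTop
  have h1 : ∀ᶠ x : ℕ in atTop, ∀ (q : ℕ) (χ : DirichletCharacter ℂ q) (t : ℝ), 1 ≤ q →
      (q : ℝ) ≤ A → |t| ≤ A * (x : ℝ) → A ≤ Sieve.pretentiousDistSq L (Sieve.twistedChar χ t) (x : ℝ) :=
    tendsto_natCast_atTop_atTop.eventually (Tao2016_liouvilleNonpretentious_holds A)
  have h2 : ∀ᶠ x : ℕ in atTop, A * Real.log (x : ℝ) ≤ (x : ℝ) := by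
    have h := (Real.isLittleO_log_id_atTop.comp_tendsto tendsto_natCast_atTop_atTop).def
      (c := 1 / A) (by positivity)
    filter_upwards [h] with x hx
    simp only [Function.comp_apply, id_eq, Real.norm_natCast] at hx
    have hx' : Real.log (x : ℝ) ≤ 1 / A * (x : ℝ) := (Real.le_norm_self _).trans hx
    calc A * Real.log (x : ℝ) ≤ A * (1 / A * (x : ℝ)) := by gcongr
      _ = x := by field_simp
  have h3 : ∀ᶠ x : ℕ in atTop, Real.log (Real.log (x : ℝ)) ≤ c / 4 * Real.log (x : ℝ) := by
    have h := (Real.isLittleO_log_id_atTop.comp_tendsto hlog).def (c := c / 4) (by positivity)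
    have h0 : ∀ᶠ x : ℕ in atTop, 0 ≤ Real.log (x : ℝ) := hlog.eventually (eventually_ge_atTop 0)
    filter_upwards [h, h0] with x hx hx0
    simp only [Function.comp_apply, id_eq] at hx
    rw [Real.norm_of_nonneg hx0] at hx
    exact (Real.le_norm_self _).trans hx
  have h4 : ∀ᶠ x : ℕ in atTop, 1 ≤ c / 4 * Real.log (x : ℝ) :=
    (hlog.const_mul_atTop (by positivity : 0 < c / 4)).eventually (eventually_ge_atTop 1)
  have h5 : ∀ᶠ x : ℕ in atTop, 1 ≤ Real.log (x : ℝ) := hlog.eventually (eventually_ge_atTop 1)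
  filter_upwards [h1, h2, h3, h4, h5, eventually_ge_atTop 1] with x hx1 hx2 hx3 hx4 hx5 hx6
  have hx0 : (0 : ℝ) < x := by exact_mod_cast hx6
  have hlx0 : 0 < Real.log (x : ℝ) := by linarith
  -- the choice `ω = x / log x`
  set ω : ℝ := (x : ℝ) / Real.log (x : ℝ) with hω
  have hω0 : 0 < ω := div_pos hx0 hlx0
  have hAω : A ≤ ω := by rwa [hω, le_div_iff₀ hlx0]
  have hωx : ω ≤ (x : ℝ) := by
    rw [hω, div_le_iff₀ hlx0]
    have := mul_le_mul_of_nonneg_left hx5 hx0.le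
    linarith
  have hxne : (x : ℝ) ≠ 0 := hx0.ne'
  have hlne : Real.log (x : ℝ) ≠ 0 := hlx0.ne'
  have hxω : (x : ℝ) / ω = Real.log (x : ℝ) := by
    rw [hω]
    field_simp
  have hlogω : Real.log ω ≤ Real.log (x : ℝ) := Real.log_le_log hω0 hωx
  have key := hA₀ A (le_max_left _ _) (x : ℝ) ω hAω le_rfl hωx L L
    (fun m n _ _ => liouville_complex_apply_mul m n) (fun m n _ _ => liouville_complex_apply_mul m n)
    (fun n hn => norm_liouville_complex_eq_one hn) (fun n hn => norm_liouville_complex_eq_one hn)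
    hx1
  rw [hxω, Nat.floor_natCast] at key
  set m : ℕ := ⌊Real.log (x : ℝ)⌋₊ with hm
  -- rewrite the summands of Theorem 2.3: `λ(a₂(a₁n+b₁)) λ(a₁(a₂n+b₂)) = λ(a₂)λ(a₁) λ(a₁n+b₁)λ(a₂n+b₂)`
  have e1 : ∀ n : ℕ, (((a₁ * a₂ : ℕ) : ℤ) * (n : ℤ) + ((a₂ * b₁ : ℕ) : ℤ)).toNat
      = a₂ * (a₁ * n + b₁) := by
    intro n
    have : ((a₁ * a₂ : ℕ) : ℤ) * (n : ℤ) + ((a₂ * b₁ : ℕ) : ℤ) = ((a₂ * (a₁ * n + b₁) : ℕ) : ℤ) := by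
      push_cast
      ring
    rw [this, Int.toNat_natCast]
  have e2 : ∀ n : ℕ, (((a₁ * a₂ : ℕ) : ℤ) * (n : ℤ) + ((a₂ * b₁ : ℕ) : ℤ)
      + (((a₁ * b₂ : ℕ) : ℤ) - ((a₂ * b₁ : ℕ) : ℤ))).toNat = a₁ * (a₂ * n + b₂) := by
    intro n
    have : ((a₁ * a₂ : ℕ) : ℤ) * (n : ℤ) + ((a₂ * b₁ : ℕ) : ℤ)
        + (((a₁ * b₂ : ℕ) : ℤ) - ((a₂ * b₁ : ℕ) : ℤ)) = ((a₁ * (a₂ * n + b₂) : ℕ) : ℤ) := by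
      push_cast
      ring
    rw [this, Int.toNat_natCast]
  have hsum : (∑ n ∈ Ioc m x, L (((a₁ * a₂ : ℕ) : ℤ) * (n : ℤ) + ((a₂ * b₁ : ℕ) : ℤ)).toNat
        * L (((a₁ * a₂ : ℕ) : ℤ) * (n : ℤ) + ((a₂ * b₁ : ℕ) : ℤ)
            + (((a₁ * b₂ : ℕ) : ℤ) - ((a₂ * b₁ : ℕ) : ℤ))).toNat / (n : ℂ))
      = L a₂ * L a₁ * ∑ n ∈ Ioc m x, L (a₁ * n + b₁) * L (a₂ * n + b₂) / (n : ℂ) := by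
    rw [Finset.mul_sum]
    refine Finset.sum_congr rfl fun n _ => ?_
    rw [e1 n, e2 n, liouville_complex_apply_mul, liouville_complex_apply_mul]
    ring
  rw [hsum, norm_mul, norm_mul, norm_liouville_complex_eq_one ha₂,
    norm_liouville_complex_eq_one ha₁, one_mul, one_mul] at key
  -- `key : ‖∑_{m < n ≤ x} λλ/n‖ ≤ c/4 · log ω`
  -- identify the complex sum with the real one
  have hcast : ∀ s : Finset ℕ, (∑ n ∈ s, L (a₁ * n + b₁) * L (a₂ * n + b₂) / (n : ℂ))
      = ((∑ n ∈ s, (ArithmeticFunction.liouville (a₁ * n + b₁) *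
          ArithmeticFunction.liouville (a₂ * n + b₂) : ℝ) / n : ℝ) : ℂ) := by
    intro s
    rw [hL]
    push_cast
    refine Finset.sum_congr rfl fun n _ => ?_
    simp only [ArithmeticFunction.intCoe_apply]
  rw [hcast, Complex.norm_real] at key
  -- split the full sum at `m = ⌊log x⌋₊ ≤ x`
  have hmx : m ≤ x := by
    rw [hm]
    refine Nat.floor_le_of_le ?_
    have := Real.log_le_self (Nat.cast_nonneg x)
    linarith
  have hsplit : (∑ n ∈ Icc 1 x, (ArithmeticFunction.liouville (a₁ * n + b₁) *
        ArithmeticFunction.liouville (a₂ * n + b₂) : ℝ) / n)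
      = (∑ n ∈ Icc 1 m, (ArithmeticFunction.liouville (a₁ * n + b₁) *
          ArithmeticFunction.liouville (a₂ * n + b₂) : ℝ) / n)
        + ∑ n ∈ Ioc m x, (ArithmeticFunction.liouville (a₁ * n + b₁) *
          ArithmeticFunction.liouville (a₂ * n + b₂) : ℝ) / n := by
    have e : ∀ k : ℕ, Icc 1 k = Ioc 0 k := fun k => by
      ext n
      simp only [Finset.mem_Icc, Finset.mem_Ioc]
      omega
    rw [e, e, Finset.sum_Ioc_consecutive _ (Nat.zero_le m) hmx]
  -- the head is at most `1 + log m ≤ 1 + log log x`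
  have hb : ∀ k : ℕ, ‖(ArithmeticFunction.liouville k : ℝ)‖ ≤ 1 := fun k => by
    have := norm_liouville_complex_le_one k
    rwa [ArithmeticFunction.intCoe_apply, Complex.norm_intCast, ← Real.norm_eq_abs] at this
  have hhead : ‖∑ n ∈ Icc 1 m, (ArithmeticFunction.liouville (a₁ * n + b₁) *
        ArithmeticFunction.liouville (a₂ * n + b₂) : ℝ) / n‖ ≤ 1 + Real.log (Real.log (x : ℝ)) := by
    calc ‖∑ n ∈ Icc 1 m, (ArithmeticFunction.liouville (a₁ * n + b₁) *
          ArithmeticFunction.liouville (a₂ * n + b₂) : ℝ) / n‖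
        ≤ ∑ n ∈ Icc 1 m, ‖(ArithmeticFunction.liouville (a₁ * n + b₁) *
          ArithmeticFunction.liouville (a₂ * n + b₂) : ℝ) / n‖ := norm_sum_le _ _
      _ ≤ ∑ n ∈ Icc 1 m, (1 : ℝ) / n := by
          refine Finset.sum_le_sum fun n hn => ?_
          rw [norm_div, Real.norm_natCast]
          apply div_le_div_of_nonneg_right _ (Nat.cast_nonneg n)
          rw [norm_mul]
          exact mul_le_one₀ (hb _) (norm_nonneg _) (hb _)
      _ ≤ 1 + Real.log m := Sieve.sum_Icc_one_div_le_one_add_log m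
      _ ≤ 1 + Real.log (Real.log (x : ℝ)) := by
          have hm1 : 1 ≤ m := Nat.le_floor (by rw [Nat.cast_one]; exact hx5)
          have := Real.log_le_log (by exact_mod_cast hm1) (Nat.floor_le hlx0.le)
          linarith
  -- conclusion
  rw [hsplit, Real.norm_of_nonneg hlx0.le]
  have htail : c / 4 * Real.log ω ≤ c / 4 * Real.log (x : ℝ) := by gcongr
  calc ‖(∑ n ∈ Icc 1 m, (ArithmeticFunction.liouville (a₁ * n + b₁) *
          ArithmeticFunction.liouville (a₂ * n + b₂) : ℝ) / n)
        + ∑ n ∈ Ioc m x, (ArithmeticFunction.liouville (a₁ * n + b₁) *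
          ArithmeticFunction.liouville (a₂ * n + b₂) : ℝ) / n‖
      ≤ (1 + Real.log (Real.log (x : ℝ))) + c / 4 * Real.log ω :=
        (norm_add_le _ _).trans (add_le_add hhead key)
    _ ≤ c * Real.log (x : ℝ) := by linarith

end Literature.NumberTheory.LFunctions
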